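import Summits.HodgeConjecture.HodgeConjecture.Theses.MilnorKExponential
import Literature.AlgebraicGeometry.HodgeTheory.SymbolClasses
import Literature.AlgebraicGeometry.HodgeTheory.HardLefschetzNFoldHolds
import Literature.AlgebraicGeometry.HodgeTheory.HodgeSectionRestrictionPairing
import Literature.AlgebraicGeometry.HodgeTheory.HodgeFiltrationModelsReductionProofs
import Literature.AlgebraicGeometry.HodgeTheory.ComplexifiedDeRhamFamily
import Literature.NumberTheory.Transcendental.DeRhamTheoremMultiplicative
import Summits.HodgeConjecture.HodgeConjecture.Theorems.MilnorKExponentialSymbolLiftRWeightOneModel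
import Summits.HodgeConjecture.HodgeConjecture.Theorems.MilnorKExponentialSymbolLiftRPowerNormalisation
import Summits.HodgeConjecture.HodgeConjecture.Theorems.MilnorKExponentialSymbolLiftRCupStep
import Summits.HodgeConjecture.HodgeConjecture.Theorems.MilnorKExponentialSymbolLiftRAdd

/-!
# Line `lefschetz-fold` for the crux `SymbolLiftR` (route `MilnorKExponential`, item stmt-HodgeConjecture-18702)

Lead's skeleton (reshape r1 of the strategist's `Lines/lefschetz_fold.lean`, 2026-08-17). The crux is
LIFT_p, `1 ≤ p = q + 1 ≤ n`: every rational `(p,p)`-class on a smooth projective complex `n`-fold is a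
symbol class of weight `p` (inlined `∃ A, A.IsSymbolNormalized q ∧ A.HasSymbolCocycle q c`; the regrouping
between the inlined text of the route decl and the named vocabulary of
`Literature.AlgebraicGeometry.HodgeTheory.SymbolClasses` is definitional and is performed inside
`SymbolLiftR_of`).

THE FOLD. The `sl₂`/Lefschetz structure of `H^*(X)` and the MULTIPLICATIVE structure of Milnor symbol
cocycles (the Čech cup product `{f₁,…,f_a} ∪ {g₁,…,g_b} = {f₁,…,f_a,g₁,…,g_b}`, transgressing to the cup
product class) fold LIFT down to its kernel: PRIMITIVE rational `(p,p)`-classes with `2 ≤ p ≤ n/2`, on ONE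
Hodge model per `X` — the model whose de Rham comparison is de Rham's integration comparison rescaled by
`(2πi)^{-k/2}` (`IsIntegrationScaled`) — which carries the weight-one symbol cocycles of all rational
`(1,1)`-classes (Lefschetz `(1,1)` in symbol form = the exponential sequence). Everything else is weight one
plus products:

* `stub_weightOneModel` (S1) — such a model exists and carries the weight-one cocycles;
* `stub_powerNormalisation` (S2) — it is symbol-normalised in every degree `2(q+1) ≤ 2n` (cup powers of the
  cocycle of a holomorphic line bundle realising a multiple of the hyperplane class; explicit staircase);
* `stub_cupStep` (S3) — on it, `h ∪ ·` carries weight-`(q+1)` symbol cocycles to weight-`(q+2)` ones (Čech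
  cup product of Milnor cocycles; the zig-zag is multiplicative; integration is multiplicative);
* `stub_add` (S4) — symbol cocycles on one model add (common refinement of the two covers);
* `stub_primitiveLift` (S5) — THE KERNEL: primitive rational `(q+2,q+2)`-classes, `2(q+2) ≤ n`, have
  weight-`(q+2)` symbol cocycles on it (first open case `(n,p) = (4,2)`).

Reshape r1 (lead): the strategist's S1 `WeightOnePackage` (normalised in ALL degrees + weight one) is split
into S1 (weight one, on the rescaled-integration model) and S2 (all-degree normalisation = cup powers), and the
hypothesis "`A` normalised in all degrees" of the old S2/S4 is replaced by `IsIntegrationScaled A`: for an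
ARBITRARY natural comparison the old hypothesis pins the comparison only through
`NaturalDeRhamComparisonRigidity_holds` and a rationality-of-scalars detour, whereas on the rescaled
integration model symbol zig-zags go to rational classes and products to cup products outright
(`integrationDeRhamIsoFamily_isMultiplicative`). The composition is unchanged otherwise.

`SymbolLiftR_of` (sorry-free): induction on the weight. Weight one is S1; normalisation of the output degree
is S2; in weight `q + 2 ≤ n`, if `2(q+1) + 1 ≤ n` the tree's Lefschetz peel
`HardLefschetzNFold.exists_eq_primitive_add_lefschetzOperator` (with
`hodgePQ_independent_of_hodgeModel_holds`) writes `c = x₀ + h ∪ β` with `β` rational `(q+1,q+1)`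
(induction + S3) and `x₀` primitive rational `(q+2,q+2)` (S5, or `x₀ = 0` when `2(q+2) = n + 1`), summed by
S4; above that range hard Lefschetz (`nonempty_hardLefschetzNFold_holds`, `exists_hdg_preimage`) writes
`c = h ∪ c'` with `c'` rational `(q+1,q+1)` and S3 applies to the induction hypothesis.

Disproof used: none — no `Disproof.lean` exists for this crux at the time of writing (payload
`disproof_path` absent on the hub); the line honours the one recorded negative,
`Theorems.MilnorKExponentialSymbolLift_refuted` (vacuity above the dimension), by never leaving
`q + 1 ≤ n` and by treating `H^{2p} = 0`-type degeneracies through `hasSymbolCocycle_zero`.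

STATE (continuation lead c1, 2026-08-17). S1–S4 are landed Theorems (p149469, p151683, p152250, p148976) and
the reduction S5 ⇒ crux is landed (`Theorems.SymbolLiftR.symbolLiftR_of_primitiveLift`, p153687, with the
crux unconditionally at `q = 0` and for `n ≤ 3`). c1 widened S3 from `h ∪ ·` to `d ∪ ·` for ANY class `d`
with a weight-one symbol cocycle (`Theorems.SymbolLiftR.hasSymbolCocycle_cup_weightOne`,
`…_lefschetzPowTo_weightOne`, `exists_model_symbolCocycles_divisorClosed`, file
`Theorems/MilnorKExponentialSymbolLiftRCupWeightOne.lean`, p155231): on the S1 model the symbol classes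
contain all rational `(1,1)` classes and are closed under sums and under cup product with rational `(1,1)`
classes, so the whole divisor-generated part of the rational Hodge ring is lifted unconditionally. The one
open stub `stub_primitiveLift` (S5) is the crux's genuine content — LIFT for primitive rational `(p,p)`
classes, `2 ≤ p ≤ n/2`, outside the divisor-generated subalgebra; first case `(n,p) = (4,2)` — and is
handed back `promote-stub` (Disproof v3 §2: any refutation of it is a counterexample to HC given Alg ⊆ L;
no proof short of new mathematics: the only printed positive evidence is the unrefereed 2001 Thm 9.6 for
Weil classes on Weil tori). Inner structure recorded for the promoted item: Ideas/constant-entry-filtration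
(TopSymbolLift ∧ GradeDescent), Ideas/appell-humbert-weight-p (abelian sector), Ideas/symbol-weak-lefschetz.

RESHAPE r2 (continuation lead c2, 2026-08-17). The open stub is restated in its logically WEAKEST form that
still folds, `stub_primitiveLiftExists` (S5∃): for `X` smooth projective of dimension `n ≥ 4` there EXIST a
hard-Lefschetz datum `Λ` and an integration-scaled Hodge model `A` on which every `Λ`-primitive rational
`(q+2,q+2)` class with `2(q+2) ≤ n` has a weight-`(q+2)` symbol cocycle. Compared with r1's S5
(`∀ Λ ∀ A`, plus a weight-one hypothesis on `A`): (i) the weight-one hypothesis is dropped — it is a THEOREM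
on every integration-scaled model (`Theorems.SymbolLiftR.hasSymbolCocycle_zero_of_integrationScaled`), so it
was idle; (ii) `∀ Λ ∀ A` becomes `∃ Λ ∃ A` — the fold (`hasSymbolCocycle_of_primitiveLiftAt`, S2, S3, S4) runs
on any ONE polarisation and any ONE integration-scaled model, so a prover of the kernel may choose both (a
very ample `Λ` with smooth hyperplane sections for the tame-symbol idea; a model built from a preferred atlas
for explicit cocycles) and never has to transport cocycles between models; (iii) `4 ≤ n` guards the vacuous
range. `stub_primitiveLiftExists_of_primitiveLift` (sorry-free, §3) certifies r1-S5 ⇒ S5∃, so the reshape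
only weakens the obligation; the composition `SymbolLiftR_of` is re-run from S5∃. Disproof read: v3 (tree,
2026-08-17T10:29Z) — no `-- Targets` for S5; `m ≠ 0`, `q + 1 ≤ n` load-bearing and kept.

STATE (continuation lead c3, cycle 4, 2026-08-17). No reshape: the one open stub is S5∃ (crux-sized; an
independent reshape audit — choice of `Λ`, middle-dimension reduction via `X × ℙ^{n-2p}`, hyperplane
sections, the "HC-known ∪ rest" and abelian/non-abelian splits — separates no provable piece). Landed
this cycle, all `--supports` (`Theorems/MilnorKExponentialSymbolLiftR<X>.lean`, namespace
`Theorems.SymbolLiftR`), the INFRASTRUCTURE every constructive proof of S5∃ needs: `Descent` (p161466: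
the symbol form kills `milnorRel` in EVERY weight; δ-closedness on the nose), `Transgression`
(p161755: abstract staircase, `exists_isTransgression`), `MilnorTransgression` (p162222: `dlog` of a
holomorphic unit is smooth and closed; every Milnor cocycle on a σ-compact T₂ complex manifold
transgresses), `TransgressionClass` (p162426: the transgressed class is independent of the zig-zag),
`TransgressionPullback` (p162692), `SymbolPullback` (p163127: units/relations/cocycles/symbol forms
pull back; `HasSymbolCocycle.map_endomorphism`), `CocycleCriterion` (p164235:
`hasSymbolCocycle_iff_forall_transgression` — the zig-zag and the form are not data), and
`SymbolPullbackMorphism` (`HasSymbolCocycle.map_of_integrationScaled` along any `ψ : Y ⟶ X`;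
`transport_of_integrationScaled`: the `∃ A` below is a `∀ A` over integration-scaled models). A proof
of S5∃ for a class `c` now owes exactly: a Milnor symbol cocycle and ONE class computation.
-/

noncomputable section

open scoped Manifold

namespace Summit.HodgeConjecture.HodgeConjecture.Cruxes.SymbolLiftR.LefschetzFold

open Literature.AlgebraicGeometry Literature.AlgebraicGeometry.HodgeTheory
open Literature.Geometry.Kaehler Literature.NumberTheory.Transcendental
open Summit.HodgeConjecture.HodgeConjecture.Theses.MilnorKExponential (SymbolLiftR)

/-! ### §1 The statements (lead's reshape r1, 2026-08-17: five stubs) -/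

/-- **The comparison of `A` is de Rham's INTEGRATION comparison rescaled by `(2πi)^{-k/2}`.** Read on
its own carrier `X^an`, in every degree `k`, the de Rham comparison `A.deRham` of the Hodge model `A` is
`((2πi)^{k/2})⁻¹ •` the complexification (`DeRhamIsoFamily.complexify`) of de Rham's integration family
`integrationDeRhamIsoFamily A.model` (`[α] ↦ (σ ↦ ∫_σ α)`; natural, multiplicative, normalised:
`integrationDeRhamIsoFamily_isNatural/_isMultiplicative/_isNormalized`). This is the ONE model on which the
whole fold runs: under it the de Rham class of the symbol zig-zag of a holomorphic line cocycle (`= 2πi ·`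
Chern form, gauge law of `HolomorphicLineBundleChernConnection`) is sent to `c₁(L)`, a RATIONAL class, and
products of symbol zig-zags go to cup products (multiplicativity of integration) with no transcendental
factor left. It replaces the all-degree normalisation hypothesis `∀ q, q + 1 ≤ n → A.IsSymbolNormalized q`
of the strategist's S2/S4 (which, for an ARBITRARY natural comparison, is usable only through
`NaturalDeRhamComparisonRigidity_holds` plus a rationality-of-scalars argument — pure overhead). -/
def IsIntegrationScaled {n : ℕ} {X : Motives.SchemeOver ℂ} (A : HodgeModel n X) : Prop :=
  ∀ (k : ℕ) (y : complexDeRhamCohomology A.model A.carrier k),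
    A.deRham A.carrier k y =
      ((2 * (Real.pi : ℂ) * Complex.I) ^ (k / 2))⁻¹ •
        (integrationDeRhamIsoFamily A.model).complexify A.carrier k y

/-- **S1 (weight-one model).** On a smooth projective complex `n`-fold, `n ≥ 1`, there is a Hodge model `A`
whose comparison is the `(2πi)^{-k/2}`-rescaled integration comparison (`IsIntegrationScaled`) and on which
every rational class of type `(1,1)` has a weight-one Milnor symbol cocycle (`A.HasSymbolCocycle 0 c`):
Lefschetz `(1,1)` in symbol form. Route: `A := { A₀ with deRham := rescaled (integration ⊗ ℂ) }` for any
model `A₀` (`nonempty_hodgeModel_holds`); for `c` rational `(1,1)`, `N • A^*c` is integral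
(`exists_nsmul_isIntegralClass_of_isRationalClass_holds`) and lies in `e₀(H^{1,1})`
(`hodgePQ_independent_of_hodgeModel_holds`), so the Chern–Weil heart of Lefschetz `(1,1)` for the
integration family (`isLefschetzOneOne_complexify_integration_of_cechIntegral` fed `CechCocycleIntegral_holds`,
re-run keeping the FINITE chart-convex cover) gives a holomorphic line cocycle `L`, a Hermitian metric `h`
and its Chern form `θ_ch` with `e₀[θ_ch] = N • A^*c`; the symbol zig-zag of `L.symbolCochain 0`
(`Z_{0,1} = -∂ log h_i`, gauge law `dPrime_logWeight_eq`) has bottom `-dω_i = 2πi • θ_ch`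
(`curvature_chernConnection_apply`, `chernCharacterForm_chernConnection_one_apply`), whence
`A.deRham[θ_sym] = N • A^*c`. Size: L. -/
def WeightOneModel : Prop :=
  ∀ ⦃n : ℕ⦄ ⦃X : Motives.SchemeOver ℂ⦄, Motives.IsSmoothProjective n X → 1 ≤ n →
    ∃ A : HodgeModel n X, IsIntegrationScaled A ∧
      ∀ c : complexBetti X (2 * (0 + 1)), IsRationalClass c →
        IsOfHodgeType n X (2 * (0 + 1)) (0 + 1) (0 + 1) c → A.HasSymbolCocycle 0 c

/-- **S2 (normalisation in every degree by cup powers).** A Hodge model of a smooth projective `n`-fold whose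
comparison is the rescaled integration comparison is symbol-normalised (`HodgeModel.IsSymbolNormalized`) in
every degree `2(q+1) ≤ 2n`. Route: the hard-Lefschetz datum `Λ` (`nonempty_hardLefschetzNFold_holds`) has a
rational class `h ∈ algebraicClasses X 1` (type `(1,1)`) with `h^{q+1} ≠ 0` for `q + 1 ≤ n` (hard Lefschetz
`L^n : H⁰ ≅ H^{2n}`); `N • A^*h` integral is `e₀[θ_ch]` for the Chern form of a Hermitian holomorphic line
cocycle `L` on a finite cover (heart of Lefschetz `(1,1)` for the integration family, as in S1); the
`(q+1)`-fold cup power `L.symbolCochain q` (`w_J = ∧_i dlog g_{J_i J_{i+1}}`) has the EXPLICIT staircase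
`Z_{a,2q+1-a} = ± α ∪ w^{∪a} ∧ θ₁^{q-a}` (`α_i = -∂ log h_i`, `w = δα`, `θ₁ = dα_i = 2πi θ_ch` global), whose
bottom is `θ₁^{q+1}`; multiplicativity of integration (`integrationDeRhamIsoFamily_isMultiplicative`,
complexified by bilinearity) and `A.deRham = (2πi)^{-(q+1)} e₀` in degree `2q+2` give
`A.deRham[θ₁^{q+1}] = ± N^{q+1} A^*(h^{q+1})`, rational and non-zero. Size: L/XL. -/
def PowerNormalisation : Prop :=
  ∀ ⦃n : ℕ⦄ ⦃X : Motives.SchemeOver ℂ⦄, Motives.IsSmoothProjective n X →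
    ∀ A : HodgeModel n X, IsIntegrationScaled A → ∀ q : ℕ, q + 1 ≤ n → A.IsSymbolNormalized q

/-- **S3 (cup step: the Lefschetz operator preserves symbol cocycles, raising the weight).** On a Hodge
model `A` with rescaled integration comparison carrying the weight-one cocycles of all rational
`(1,1)`-classes, and for a hard-Lefschetz datum `Λ` (its class `h = Λ.hyperplaneClass` is rational and in
`algebraicClasses X 1`, hence of type `(1,1)` and — by the hypothesis — has a weight-one symbol cocycle on
`A`): if `c ∈ H^{2(q+1)}` has a weight-`(q+1)` symbol cocycle on `A` then `h ∪ c ∈ H^{2(q+2)}` has a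
weight-`(q+2)` symbol cocycle on `A`. Mechanism: on the product cover, the Čech cup product of the Milnor
cocycle `σ` of `c` (front face) with the weight-one cocycle `τ` of `h` (back face) is a weight-`(q+2)`
Milnor cocycle (`{f₁,…,f_{q+1}}·{g}`; relations slotwise), its symbol forms are `symbolForm σ ∧ dlog g`
(`dlogWedge_succ`), and from the zig-zag `Z` of `σ` (bottom `θ`) and `(α, θ_h)` of `τ` the cochain
`T = ±θ ∪ α + Z ∪ θ_h + Z ∪ Dα` is a zig-zag of the product with bottom `θ ∧ θ_h` (Leibniz for `δ` and `d`
against the Čech–de Rham cup product `(x ∪ y)_J = x_{front J} ∧ y_{back J}`); then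
`A.deRham[θ ∧ θ_h] = (2πi)^{-(q+2)} e₀[θ] ∪ e₀[θ_h] = m m₁ • A^*(c) ∪ A^*(h) = ± m m₁ • A^*(h ∪ c)`
(multiplicativity of integration, `cupProduct` graded commutativity, pull-back multiplicative). Size: XL. -/
def CupStep : Prop :=
  ∀ ⦃n : ℕ⦄ ⦃X : Motives.SchemeOver ℂ⦄, Motives.IsSmoothProjective n X →
    ∀ (Λ : HardLefschetzNFold n X) (A : HodgeModel n X), IsIntegrationScaled A →
      (∀ c : complexBetti X (2 * (0 + 1)), IsRationalClass c →
        IsOfHodgeType n X (2 * (0 + 1)) (0 + 1) (0 + 1) c → A.HasSymbolCocycle 0 c) →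
      ∀ (q : ℕ) (c : complexBetti X (2 * (q + 1))), q + 2 ≤ n →
        A.HasSymbolCocycle q c →
          A.HasSymbolCocycle (q + 1)
            (lefschetzOperator Λ.hyperplaneClass (two_add_two_mul (q + 1)) c)

/-- **S4 (symbol cocycles on one model add).** If `c` and `c'` have weight-`(q+1)` symbol cocycles on
the SAME Hodge model `A` then so does `c + c'`: refine both Milnor cocycles and both zig-zags to the
common refinement `U × U'` of the two finite covers (good tuples and Milnor relations are antitone in
the open set, `CechForms` restrict by re-indexing along `Prod.fst`/`Prod.snd`, `cechδ`/`cechd` commute with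
the re-indexing), and take `m' • σ̃ + m • σ̃'`, `m' • θ + m • θ'`, integer `m m'`. The tree proves only
`neg`/`zsmul`/`of_zsmul` (no refinement needed); this is the missing additivity. Size: M. -/
def SymbolCocycleAdd : Prop :=
  ∀ ⦃n : ℕ⦄ ⦃X : Motives.SchemeOver ℂ⦄ (A : HodgeModel n X) (q : ℕ)
    (c c' : complexBetti X (2 * (q + 1))),
    A.HasSymbolCocycle q c → A.HasSymbolCocycle q c' → A.HasSymbolCocycle q (c + c')

/-- **S5 — THE KERNEL (primitive LIFT in the lower half).** On a smooth projective `n`-fold with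
hard-Lefschetz datum `Λ` and a Hodge model `A` as in S1 (rescaled integration comparison, weight-one
cocycles), every PRIMITIVE rational class of type `(q+2, q+2)` in `H^{2(q+2)}`, `2(q+2) ≤ n` (primitive:
`L^j c = 0` for `2(q+2) + j = n + 1`), has a weight-`(q+2)` Milnor symbol cocycle on `A`. This is exactly
what is left of LIFT after the Lefschetz fold. First open case `(n, p) = (4, 2)`: primitive rational
`(2,2)`-classes on fourfolds (Weil classes on Weil abelian fourfolds, `S × S'` with `p_g ≥ 1`, HK/CY
fourfolds). Why it might be provable short of HC: symbol cocycles need not come from algebraic cycles; why it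
might fail: `∂_p` is an absolute-Hodge-type obstruction. Size: open problem. -/
def PrimitiveLift : Prop :=
  ∀ ⦃n : ℕ⦄ ⦃X : Motives.SchemeOver ℂ⦄, Motives.IsSmoothProjective n X →
    ∀ (Λ : HardLefschetzNFold n X) (A : HodgeModel n X), IsIntegrationScaled A →
      (∀ c : complexBetti X (2 * (0 + 1)), IsRationalClass c →
        IsOfHodgeType n X (2 * (0 + 1)) (0 + 1) (0 + 1) c → A.HasSymbolCocycle 0 c) →
      ∀ (q : ℕ), 2 * (q + 2) ≤ n →
        ∀ (c : complexBetti X (2 * (q + 1 + 1))), IsRationalClass c →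
          IsOfHodgeType n X (2 * (q + 1 + 1)) (q + 1 + 1) (q + 1 + 1) c →
          (∃ (j t : ℕ) (ht : 2 * (q + 1 + 1) + 2 * j = t),
              2 * (q + 1 + 1) + j = n + 1 ∧ Λ.L j (2 * (q + 1 + 1)) t ht c = 0) →
            A.HasSymbolCocycle (q + 1) c

/-- **S5∃ — THE KERNEL in its weakest folding form (reshape r2).** For `X` smooth projective of
dimension `n ≥ 4` there EXIST a hard-Lefschetz datum `Λ` and a Hodge model `A` with rescaled integration
comparison (`IsIntegrationScaled`) such that every `Λ`-PRIMITIVE rational class of type `(q+2, q+2)` in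
`H^{2(q+2)}`, `2(q+2) ≤ n`, has a weight-`(q+2)` Milnor symbol cocycle on `A`. Implied by `PrimitiveLift`
(`stub_primitiveLiftExists_of_primitiveLift`); sufficient for the crux (`SymbolLiftR_of`) because the fold runs
on any one polarisation and any one integration-scaled model, weight one being automatic there
(`hasSymbolCocycle_zero_of_integrationScaled`). Mathematically the same open problem: LIFT_p for primitive
rational `(p,p)` classes, `2 ≤ p ≤ n/2`; first case `(n, p) = (4, 2)`. -/
def PrimitiveLiftExists : Prop :=
  ∀ ⦃n : ℕ⦄ ⦃X : Motives.SchemeOver ℂ⦄, Motives.IsSmoothProjective n X → 4 ≤ n →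
    ∃ (Λ : HardLefschetzNFold n X) (A : HodgeModel n X), IsIntegrationScaled A ∧
      ∀ (q : ℕ), 2 * (q + 2) ≤ n →
        ∀ (c : complexBetti X (2 * (q + 1 + 1))), IsRationalClass c →
          IsOfHodgeType n X (2 * (q + 1 + 1)) (q + 1 + 1) (q + 1 + 1) c →
          (∃ (j t : ℕ) (ht : 2 * (q + 1 + 1) + 2 * j = t),
              2 * (q + 1 + 1) + j = n + 1 ∧ Λ.L j (2 * (q + 1 + 1)) t ht c = 0) →
            A.HasSymbolCocycle (q + 1) c

/-! ### §2 The stubs (S1–S4 closed by landed Theorems files; the ONLY `sorry` left is S5∃)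

Each stub is stated UNFOLDED (no reference to the `def`s of §1, `IsIntegrationScaled` inlined), so that the
registered signature is a text a Theorems file can reproduce verbatim with the `open`s of this file; the
`example` at the end of §3 certifies that the unfolded texts are definitionally the named statements. -/

/-- STUB S1 (registered, CLOSED by `Theorems.SymbolLiftR.stub_weightOneModel`, p149469): `WeightOneModel`, unfolded. -/
theorem stub_weightOneModel : ∀ ⦃n : ℕ⦄ ⦃X : Motives.SchemeOver ℂ⦄, Motives.IsSmoothProjective n X → 1 ≤ n → ∃ A : HodgeModel n X, (∀ (k : ℕ) (y : complexDeRhamCohomology A.model A.carrier k), A.deRham A.carrier k y = ((2 * (Real.pi : ℂ) * Complex.I) ^ (k / 2))⁻¹ • (integrationDeRhamIsoFamily A.model).complexify A.carrier k y) ∧ (∀ c : complexBetti X (2 * (0 + 1)), IsRationalClass c → IsOfHodgeType n X (2 * (0 + 1)) (0 + 1) (0 + 1) c → A.HasSymbolCocycle 0 c) :=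
  _root_.Summit.HodgeConjecture.HodgeConjecture.Theorems.SymbolLiftR.stub_weightOneModel

/-- STUB S2 (registered, CLOSED by `Theorems.SymbolLiftR.stub_powerNormalisation`, p151683): `PowerNormalisation`, unfolded. -/
theorem stub_powerNormalisation : ∀ ⦃n : ℕ⦄ ⦃X : Motives.SchemeOver ℂ⦄, Motives.IsSmoothProjective n X → ∀ A : HodgeModel n X, (∀ (k : ℕ) (y : complexDeRhamCohomology A.model A.carrier k), A.deRham A.carrier k y = ((2 * (Real.pi : ℂ) * Complex.I) ^ (k / 2))⁻¹ • (integrationDeRhamIsoFamily A.model).complexify A.carrier k y) → ∀ q : ℕ, q + 1 ≤ n → A.IsSymbolNormalized q :=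
  _root_.Summit.HodgeConjecture.HodgeConjecture.Theorems.SymbolLiftR.stub_powerNormalisation

/-- STUB S3 (registered, CLOSED by `Theorems.SymbolLiftR.stub_cupStep`, p152250): `CupStep`, unfolded. -/
theorem stub_cupStep : ∀ ⦃n : ℕ⦄ ⦃X : Motives.SchemeOver ℂ⦄, Motives.IsSmoothProjective n X → ∀ (Λ : HardLefschetzNFold n X) (A : HodgeModel n X), (∀ (k : ℕ) (y : complexDeRhamCohomology A.model A.carrier k), A.deRham A.carrier k y = ((2 * (Real.pi : ℂ) * Complex.I) ^ (k / 2))⁻¹ • (integrationDeRhamIsoFamily A.model).complexify A.carrier k y) → (∀ c : complexBetti X (2 * (0 + 1)), IsRationalClass c → IsOfHodgeType n X (2 * (0 + 1)) (0 + 1) (0 + 1) c → A.HasSymbolCocycle 0 c) → ∀ (q : ℕ) (c : complexBetti X (2 * (q + 1))), q + 2 ≤ n → A.HasSymbolCocycle q c → A.HasSymbolCocycle (q + 1) (lefschetzOperator Λ.hyperplaneClass (two_add_two_mul (q + 1)) c) :=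
  _root_.Summit.HodgeConjecture.HodgeConjecture.Theorems.SymbolLiftR.stub_cupStep

/-- STUB S4 (registered, CLOSED by `Theorems.SymbolLiftR.stub_add`, p148976): `SymbolCocycleAdd`, unfolded. -/
theorem stub_add : ∀ ⦃n : ℕ⦄ ⦃X : Motives.SchemeOver ℂ⦄ (A : HodgeModel n X) (q : ℕ) (c c' : complexBetti X (2 * (q + 1))), A.HasSymbolCocycle q c → A.HasSymbolCocycle q c' → A.HasSymbolCocycle q (c + c') :=
  _root_.Summit.HodgeConjecture.HodgeConjecture.Theorems.SymbolLiftR.stub_add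

/-- STUB S5∃ (registered, the kernel, reshape r2): `PrimitiveLiftExists`, unfolded (`IsIntegrationScaled`
inlined). It replaces r1's `stub_primitiveLift` (which implies it: `stub_primitiveLiftExists_of_primitiveLift`). -/
theorem stub_primitiveLiftExists : ∀ ⦃n : ℕ⦄ ⦃X : Motives.SchemeOver ℂ⦄, Motives.IsSmoothProjective n X → 4 ≤ n → ∃ (Λ : HardLefschetzNFold n X) (A : HodgeModel n X), (∀ (k : ℕ) (y : complexDeRhamCohomology A.model A.carrier k), A.deRham A.carrier k y = ((2 * (Real.pi : ℂ) * Complex.I) ^ (k / 2))⁻¹ • (integrationDeRhamIsoFamily A.model).complexify A.carrier k y) ∧ ∀ (q : ℕ), 2 * (q + 2) ≤ n → ∀ (c : complexBetti X (2 * (q + 1 + 1))), IsRationalClass c → IsOfHodgeType n X (2 * (q + 1 + 1)) (q + 1 + 1) (q + 1 + 1) c → (∃ (j t : ℕ) (ht : 2 * (q + 1 + 1) + 2 * j = t), 2 * (q + 1 + 1) + j = n + 1 ∧ Λ.L j (2 * (q + 1 + 1)) t ht c = 0) → A.HasSymbolCocycle (q + 1) c := by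
  sorry

/-! ### Name-keyed aliases (the skeleton audit admits a hypothesis of `SymbolLiftR_of` iff the head
constant of its type has the short name of a declared stub) -/
namespace Registered

/-- Alias of `WeightOneModel` keyed by the registered stub name. -/
abbrev stub_weightOneModel : Prop := WeightOneModel
/-- Alias of `PowerNormalisation` keyed by the registered stub name. -/
abbrev stub_powerNormalisation : Prop := PowerNormalisation
/-- Alias of `CupStep` keyed by the registered stub name. -/
abbrev stub_cupStep : Prop := CupStep
/-- Alias of `SymbolCocycleAdd` keyed by the registered stub name. -/
abbrev stub_add : Prop := SymbolCocycleAdd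
/-- Alias of `PrimitiveLift` keyed by r1's stub name (no longer registered; kept for the comparison lemma). -/
abbrev stub_primitiveLift : Prop := PrimitiveLift
/-- Alias of `PrimitiveLiftExists` keyed by the registered stub name (reshape r2). -/
abbrev stub_primitiveLiftExists : Prop := PrimitiveLiftExists

end Registered

/-! ### §3 The composition (no `sorry` below this line) -/

/-- **The reshape only weakens the obligation**: r1's kernel `PrimitiveLift` (`∀ Λ ∀ A` with the
weight-one hypothesis) implies r2's `PrimitiveLiftExists` (`∃ Λ ∃ A`): take the tree's hard-Lefschetz datum
(`nonempty_hardLefschetzNFold_holds`) and the weight-one model of S1. -/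
theorem stub_primitiveLiftExists_of_primitiveLift (h4 : Registered.stub_primitiveLift) :
    Registered.stub_primitiveLiftExists := by
  intro n X hX _
  obtain ⟨Λ⟩ := nonempty_hardLefschetzNFold_holds n X hX
  obtain ⟨A, hA, hone⟩ := stub_weightOneModel hX (by omega)
  exact ⟨Λ, A, hA, h4 hX Λ A hA hone⟩

/-- **The Lefschetz fold**: the one open stub S5∃ (with the landed S1–S4) implies the crux `SymbolLiftR` BY NAME. Pure logic over the
tree: `nonempty_hardLefschetzNFold_holds` (hard Lefschetz, proved),
`HardLefschetzNFold.exists_eq_primitive_add_lefschetzOperator` (the Lefschetz peel with rationality and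
Hodge types, proved), `hodgePQ_independent_of_hodgeModel_holds`, `exists_hdg_preimage` (Hodge classes
above the middle are `L^j` of Hodge classes below), `hasSymbolCocycle_zero_of_integrationScaled` (weight one
is automatic on an integration-scaled model), `HasSymbolCocycle` bookkeeping, and the definitional
regrouping between the named vocabulary and the inlined route decl. For `n ≤ 3` the kernel is never met and
the polarisation / model come from the tree (`nonempty_hardLefschetzNFold_holds`, S1); for `n ≥ 4` both come
from S5∃. -/
theorem SymbolLiftR_of (h5 : Registered.stub_primitiveLiftExists) : SymbolLiftR := by
  have h1 : Registered.stub_weightOneModel := stub_weightOneModel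
  have hN : Registered.stub_powerNormalisation := stub_powerNormalisation
  have h2 : Registered.stub_cupStep := stub_cupStep
  have h3 : Registered.stub_add := stub_add
  -- Step 0: it suffices to prove the named form (the regrouping is definitional).
  suffices key : ∀ ⦃n : ℕ⦄ ⦃X : Motives.SchemeOver ℂ⦄, Motives.IsSmoothProjective n X →
      ∀ (q : ℕ), q + 1 ≤ n → ∀ (c : complexBetti X (2 * (q + 1))), IsRationalClass c →
        IsOfHodgeType n X (2 * (q + 1)) (q + 1) (q + 1) c →
          ∃ A : HodgeModel n X, A.IsSymbolNormalized q ∧ A.HasSymbolCocycle q c by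
    intro n X hX q hq c hc hpp
    obtain ⟨A, hNA, hS⟩ := key hX q hq c hc hpp
    refine ⟨A, ?_, ?_⟩
    · obtain ⟨ι, hι, L, θ₀, c₀, hT, hr, hne, hde⟩ := hNA
      exact ⟨ι, hι, L, θ₀, c₀, hT, hr, hne, hde⟩
    · obtain ⟨ι, hι, U, hU, hcov, σ, hσ, θ, m, hm, hT, hde⟩ := hS
      exact ⟨ι, hι, U, hU, hcov, σ, hσ.1, hσ.2, θ, m, hm, hT, hde⟩
  intro n X hX q₀ hq₀ c₀ hc₀ hpp₀
  -- Step 1: ONE polarisation and ONE integration-scaled model carrying the primitive lifts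
  -- (from S5∃ when `n ≥ 4`; from the tree when `n ≤ 3`, where the kernel is vacuous).
  obtain ⟨Λ, A, hA, h4⟩ : ∃ (Λ : HardLefschetzNFold n X) (A : HodgeModel n X),
      IsIntegrationScaled A ∧
        ∀ (q : ℕ), 2 * (q + 2) ≤ n → ∀ (c : complexBetti X (2 * (q + 1 + 1))), IsRationalClass c →
          IsOfHodgeType n X (2 * (q + 1 + 1)) (q + 1 + 1) (q + 1 + 1) c →
          (∃ (j t : ℕ) (ht : 2 * (q + 1 + 1) + 2 * j = t),
              2 * (q + 1 + 1) + j = n + 1 ∧ Λ.L j (2 * (q + 1 + 1)) t ht c = 0) →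
            A.HasSymbolCocycle (q + 1) c := by
    by_cases h4n : 4 ≤ n
    · exact h5 hX h4n
    · obtain ⟨Λ⟩ := nonempty_hardLefschetzNFold_holds n X hX
      obtain ⟨A, hA, -⟩ := h1 hX (by omega)
      exact ⟨Λ, A, hA, fun q hq ↦ absurd hq (by omega)⟩
  -- weight one is automatic on an integration-scaled model (Lefschetz `(1,1)` in symbol form)
  have hone : ∀ c : complexBetti X (2 * (0 + 1)), IsRationalClass c →
      IsOfHodgeType n X (2 * (0 + 1)) (0 + 1) (0 + 1) c → A.HasSymbolCocycle 0 c :=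
    fun c hc h11 ↦
      _root_.Summit.HodgeConjecture.HodgeConjecture.Theorems.SymbolLiftR.hasSymbolCocycle_zero_of_integrationScaled
        hX A hA c hc h11
  refine ⟨A, hN hX A hA q₀ hq₀, ?_⟩
  have hI : hodgePQ_independent_of_hodgeModel := hodgePQ_independent_of_hodgeModel_holds
  -- Step 2: induction on the weight.
  have main : ∀ q : ℕ, q + 1 ≤ n → ∀ c : complexBetti X (2 * (q + 1)), IsRationalClass c →
      IsOfHodgeType n X (2 * (q + 1)) (q + 1) (q + 1) c → A.HasSymbolCocycle q c := by
    intro q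
    induction q with
    | zero =>
      intro _ c hc hpp
      exact hone c hc hpp
    | succ q ih =>
      intro hq c hc hpp
      by_cases hlow : 2 * (q + 1) + 1 ≤ n
      · -- (a) the Lefschetz peel `c = x₀ + h ∪ β`, `x₀` primitive
        obtain ⟨j, hj⟩ : ∃ j : ℕ, 2 * (q + 1) + (j + 1) = n :=
          ⟨n - (2 * (q + 1) + 1), by omega⟩
        obtain ⟨x₀, β, hx, hprim, hrat, htyp⟩ :=
          Λ.exists_eq_primitive_add_lefschetzOperator hj (two_add_two_mul (q + 1)) rfl c
        obtain ⟨hx₀Q, hβQ⟩ := hrat hc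
        have hcA : A.pullback (2 * (q + 1 + 1)) c ∈
            A.hodgePQ (2 * (q + 1 + 1)) (q + 1 + 1) (q + 1 + 1) :=
          (hI.isOfHodgeType_iff hX A).1 hpp
        obtain ⟨hx₀A, hβA⟩ := htyp A (q + 1) (q + 1) hI hX hcA
        have hβT : IsOfHodgeType n X (2 * (q + 1)) (q + 1) (q + 1) β := ⟨A, hβA⟩
        have hx₀T : IsOfHodgeType n X (2 * (q + 1 + 1)) (q + 1 + 1) (q + 1 + 1) x₀ := ⟨A, hx₀A⟩
        have hβS : A.HasSymbolCocycle q β := ih (by omega) β hβQ hβT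
        have hLβS : A.HasSymbolCocycle (q + 1)
            (lefschetzOperator Λ.hyperplaneClass (two_add_two_mul (q + 1)) β) :=
          h2 hX Λ A hA hone q β (by omega) hβS
        have hx₀S : A.HasSymbolCocycle (q + 1) x₀ := by
          by_cases hmid : 2 * (q + 2) ≤ n
          · exact h4 q hmid x₀ hx₀Q hx₀T ⟨j, _, rfl, by omega, hprim⟩
          · -- `2(q+2) = n + 1`: `j = 0` and `x₀ = L⁰ x₀ = 0`
            obtain rfl : j = 0 := by omega
            have hx₀0 : x₀ = 0 := hprim
            rw [hx₀0]
            exact A.hasSymbolCocycle_zero (q + 1)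
        rw [hx]
        exact h3 A (q + 1) x₀ _ hx₀S hLβS
      · -- (b) above the peel range: `c = h ∪ c'` by hard Lefschetz
        obtain ⟨e, he⟩ : ∃ e : ℕ, e + (q + 2) = n := ⟨n - (q + 2), by omega⟩
        obtain ⟨d, hd⟩ : ∃ d : ℕ, n + (d + 1) = 2 * (q + 2) := ⟨2 * (q + 2) - n - 1, by omega⟩
        have hjk : 2 * e + (d + 1) = n := by omega
        have hm : 2 * e + 2 * (d + 1) = 2 * (q + 1 + 1) := by omega
        have hpp' : IsOfHodgeType n X (2 * (q + 1 + 1)) (e + (d + 1)) (e + (d + 1)) c := by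
          have hed : e + (d + 1) = q + 1 + 1 := by omega
          rw [hed]
          exact hpp
        obtain ⟨c', hc'Q, hc'T, hcc'⟩ :=
          Λ.exists_hdg_preimage hjk (2 * (q + 1 + 1)) hm e e c hc hpp'
        have hm' : 2 * e + 2 * d = 2 * (q + 1) := by omega
        -- `c'' = L^d c'`, rational of type `(q+1, q+1)`
        have hc''Q : IsRationalClass (Λ.L d (2 * e) (2 * (q + 1)) hm' c') :=
          Λ.isRationalClass_L d (2 * e) (2 * (q + 1)) hm' hc'Q
        have hc''T : IsOfHodgeType n X (2 * (q + 1)) (q + 1) (q + 1)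
            (Λ.L d (2 * e) (2 * (q + 1)) hm' c') := by
          have hed : e + d = q + 1 := by omega
          have h := Λ.isOfHodgeType_L d (2 * e) (2 * (q + 1)) hm' e e hc'T
          rw [hed] at h
          exact h
        have hc''S : A.HasSymbolCocycle q (Λ.L d (2 * e) (2 * (q + 1)) hm' c') :=
          ih (by omega) _ hc''Q hc''T
        have key : c = lefschetzOperator Λ.hyperplaneClass (two_add_two_mul (q + 1))
            (Λ.L d (2 * e) (2 * (q + 1)) hm' c') := by
          rw [← hcc']
          exact lefschetzPowTo_succ_apply Λ.hyperplaneClass d (2 * e) (2 * (q + 1))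
            (2 * (q + 1 + 1)) hm' hm (two_add_two_mul (q + 1)) c'
        rw [key]
        exact h2 hX Λ A hA hone q _ (by omega) hc''S
  exact main q₀ hq₀ c₀ hc₀ hpp₀


/-- Wiring check: the UNFOLDED registered stubs feed the composition as stated (definitional unfolding
only: each `stub_x` has, up to `δ`-reduction of the §1 `def`s, the type `Registered.stub_x`). -/
example : SymbolLiftR :=
  SymbolLiftR_of stub_primitiveLiftExists

end Summit.HodgeConjecture.HodgeConjecture.Cruxes.SymbolLiftR.LefschetzFold

end
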